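import Summits.ResolutionOfSingularities.ResolutionOfSingularities.Theorems.IndSmoothValuativeSmoothingSmoothNbhd
import Literature.AlgebraicGeometry.Resolution.LocalBlowup
import HarnessLib

/-!
# From a regular centre on an affine model to the smooth factorisation
# (crux `IndSmooth.ValuativeSmoothing`, line `birth`, stub `stub_smoothFactorOfLocAtCentre`)

Stub `stub_smoothFactorOfLocAtCentre` of the skeleton `Lines/birth.lean` (lead reshape r5,
family 4: "regular centre of dimension `≤ 2` on some affine model") for crux
stmt-ResolutionOfSingularities-16087. Over a PERFECT field `k`, let `(K, O)` be a valued field,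
`C ⊆ O` a finitely generated `k`-subalgebra of `K` whose local ring at the centre of `O`,
`locAtCentre C O = C_{𝔪_O ∩ C} ⊆ K`, is a regular local ring, and `R` a finitely generated
`k`-subalgebra of `K` with `R ⊆ locAtCentre C O`. Then the inclusion `R → O` factors as
`R → T → O ⊆ K` through a smooth `k`-algebra `T`.

Proof. Let `s` be a finite generating set of `R`; each `r ∈ s` is a fraction `r = y_r / z_r` with
`y_r, z_r ∈ C` and `O.valuation z_r = 1`, so `z_r⁻¹ ∈ locAtCentre C O ⊆ O`. The finitely generated
subalgebra `C' := C[z_r⁻¹ : r ∈ s]` satisfies `R ≤ C' ≤ locAtCentre C O ⊆ O`, hence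
`locAtCentre C' O = locAtCentre C O` (monotonicity and idempotence of `locAtCentre`), so `C'` is
regular at the centre of `O`; reading this regularity on `Localization.AtPrime (𝔪_O ∩ C')`
(`isRegularLocalRing_locAtCentre_iff`), the landed `stub_smoothNbhd` (regular ⇒ smooth at the
centre over a perfect field, and the smooth locus is open) provides a finitely generated smooth
`N' ⊆ O` with `C' ≤ N'`; take `T := N'` with the inclusions `R → N' → K`.
-/

-- single-problem summit: the doubled namespace component is forced
set_option linter.dupNamespace false

namespace Summit.ResolutionOfSingularities.ResolutionOfSingularities.Theorems.ValuativeSmoothing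

open IsLocalRing Literature.AlgebraicGeometry.Resolution

/-- **Stub `stub_smoothFactorOfLocAtCentre` (line `birth`, crux `IndSmooth.ValuativeSmoothing`;
r5-S3).** Over a perfect field `k`: if `C ⊆ O` is a finitely generated `k`-subalgebra of the
valued field `(K, O)` which is regular at the centre of `O` (`locAtCentre C O` regular), then
every finitely generated `k`-subalgebra `R ⊆ locAtCentre C O` factors `R → T → O ⊆ K` through a
smooth `k`-algebra `T`. Writing the finitely many generators of `R` as fractions `y / z`,
`y, z ∈ C`, `ν(z) = 0`, and adjoining the `z⁻¹` to `C` gives a finitely generated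
`C' ⊆ locAtCentre C O` containing `R` with the same local ring at the centre; then
`stub_smoothNbhd` (regular ⇒ smooth neighbourhood over a perfect field) gives a smooth finitely
generated `N'`, `C' ≤ N' ⊆ O`. [cite: Matsumura1987, §30 Remark 2 after Thm. 30.3] -/
theorem stub_smoothFactorOfLocAtCentre (k K : Type) [Field k] [PerfectField k] [Field K]
    [Algebra k K] (O : ValuationSubring K) (C : Subalgebra k K) (hCfg : C.FG)
    (hCO : C.toSubring ≤ O.toSubring) (hreg : IsRegularLocalRing (locAtCentre C.toSubring O))
    (R : Subalgebra k K) (hR : R.FG) (hRC : R.toSubring ≤ locAtCentre C.toSubring O) :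
    ∃ (T : Type) (_ : CommRing T) (_ : Algebra k T), Algebra.Smooth k T ∧
      ∃ (ψ : R →ₐ[k] T) (χ : T →ₐ[k] K), (∀ t : T, χ t ∈ O) ∧ ∀ r : R, χ (ψ r) = (r : K) := by
  classical
  -- a finite generating set `s` of `R`; each generator is a fraction `y r / z r`, `ν(z r) = 0`
  obtain ⟨s, hs⟩ := hR
  have hmem : ∀ r ∈ s, ∃ y ∈ C, ∃ z ∈ C, O.valuation z = 1 ∧ r = y / z := fun r hr =>
    hRC (show r ∈ R from hs ▸ Algebra.subset_adjoin hr)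
  choose! y hy z hz hv hyz using hmem
  -- `locAtCentre C O` as a `k`-subalgebra of `K`
  let L : Subalgebra k K :=
    { locAtCentre C.toSubring O with
      algebraMap_mem' := fun c => le_locAtCentre C.toSubring O (C.algebraMap_mem c) }
  have hCL : C ≤ L := fun x hx => le_locAtCentre C.toSubring O hx
  -- `C' := C[z r⁻¹ : r ∈ s]`
  let C' : Subalgebra k K := C ⊔ Algebra.adjoin k (↑(s.image fun r => (z r)⁻¹) : Set K)
  have hC'fg : C'.FG := hCfg.sup (Subalgebra.fg_adjoin_finset _)
  have hCC' : C ≤ C' := le_sup_left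
  have hC'L : C' ≤ L := by
    refine sup_le hCL (Algebra.adjoin_le ?_)
    intro x hx
    rw [Finset.coe_image] at hx
    obtain ⟨r, hr, rfl⟩ := hx
    exact inv_mem_locAtCentre (le_locAtCentre C.toSubring O (hz r hr)) (hv r hr)
  have hC'L' : C'.toSubring ≤ locAtCentre C.toSubring O := fun x hx => hC'L hx
  have hC'O : C'.toSubring ≤ O.toSubring := hC'L'.trans (locAtCentre_le hCO)
  -- `R ≤ C'`
  have hRC' : R ≤ C' := by
    rw [← hs]
    refine Algebra.adjoin_le ?_
    intro r hr
    have hr' : r ∈ (s : Set K) := hr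
    rw [Finset.mem_coe] at hr'
    rw [hyz r hr', div_eq_mul_inv]
    refine C'.mul_mem (hCC' (hy r hr')) ?_
    refine Algebra.mem_sup_right (Algebra.subset_adjoin ?_)
    rw [Finset.coe_image]
    exact ⟨r, hr', rfl⟩
  -- `locAtCentre C' O = locAtCentre C O`, so `C'` is regular at the centre of `O`
  have hLL : locAtCentre C'.toSubring O = locAtCentre C.toSubring O :=
    le_antisymm ((locAtCentre_mono O hC'L').trans (locAtCentre_locAtCentre C.toSubring O).le)
      (locAtCentre_mono O fun x hx => hCC' hx)
  have hregC' : IsRegularLocalRing (locAtCentre C'.toSubring O) := by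
    rw [hLL]
    exact hreg
  have hreg' := (isRegularLocalRing_locAtCentre_iff hC'O).mp hregC'
  -- the smooth neighbourhood of the regular centre (`stub_smoothNbhd`)
  obtain ⟨N', hN'O, -, hsmooth, hC'N'⟩ := stub_smoothNbhd k K O C' hC'O hC'fg hreg'
  exact ⟨N', inferInstance, inferInstance, hsmooth, Subalgebra.inclusion (hRC'.trans hC'N'),
    N'.val, fun t => hN'O t.2, fun _ => rfl⟩

end Summit.ResolutionOfSingularities.ResolutionOfSingularities.Theorems.ValuativeSmoothing
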